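import Summits.FinalStateConjecture.FinalStateConjecture.Theorems.SwallowTheDatumParametricKerrBurialCollarLine
import Literature.Geometry.Lorentzian.InitialDataLocality
import Literature.Geometry.Lorentzian.InitialDataDilation
import Literature.Geometry.Lorentzian.ModelData
import Mathlib.Analysis.SpecialFunctions.SmoothTransition
import Mathlib.Analysis.Calculus.Deriv.Slope
import Mathlib.Analysis.InnerProductSpace.Calculus
import HarnessLib

/-!
# Stub `stub_socketBag_of_plugDataPlusFrom` of the line `Sketch` (crux
# `SwallowTheDatum.UniversalWitnessFamily`, item stmt-FinalStateConjecture-10051): from PlugData⁺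
# to the universal socket bag by a radial stretch

The hypothesis (PlugData⁺ with the exterior mass `M` prescribed) provides, for every `μ₀ > 0` and
`M > 0`, an everywhere-vacuum datum `D₀` on `E3 = ℝ³` which is EXACTLY time-symmetric isotropic
Schwarzschild(`M`), `((1 + M/2‖y‖)⁴ δ, 0)`, on `{‖y‖ > ρ₃}` (`ρ₃ < M/40`) and, on the small annulus
`{λ < ‖y‖ < 2λ}` (`2λ < ρ₃`), the NON-canonically normalised socket
`(λ⁻² (1 + λμ/2‖y‖)⁴ δ, 0)`, `0 < μ ≤ μ₀`.  The conclusion is the UNIVERSAL SOCKET BAG of the line: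
a datum `C` on `E3`, vacuum off the unit ball, exactly the canonical socket `((1 + μ/2‖y‖)⁴ δ, 0)`
on `{1 < ‖y‖ < 2}` and exactly Schwarzschild(`M`) beyond `M/2`, `M > 4`.

PROOF.  Take `M := 8` (so `ρ₃ < 1/5`, `λ < 1/10`) and pull `D₀` back (`InitialDataSet.comap`,
Bartnik–Isenberg 2004 §2: the constraint map is diffeomorphism-equivariant, here
`isVacuumConstraintSolution_comap'`) along the RADIAL STRETCH `Φ z = G(‖z‖²) z` of `E3`, where the
smooth non-decreasing profile `G = λ + (1 − λ) S((t − 5)/10)` (`S = Real.smoothTransition`) equals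
`λ` for `t ≤ 5` and `1` for `t ≥ 15`.  `Φ` is a smooth immersion (`dΦ_z v = G v + 2 G′ ⟪z, v⟫ z`,
`⟪dΦ_z v, v⟫ ≥ λ ‖v‖²`), it is the homothety `z ↦ λ z` near the socket annulus `{1 < ‖z‖ < 2}`
(whence `C = Φ^* D₀` reads `λ² · λ⁻² (1 + λμ/(2λ‖z‖))⁴ δ = (1 + μ/2‖z‖)⁴ δ`, `k = 0` there) and the
identity near `{‖z‖ > 4}` (whence `C = D₀ =` Schwarzschild(`8`) there, as `4 > ρ₃`).
References: Bartnik–Isenberg 2004 §2; Misner–Thorne–Wheeler 1973 (31.22); the skeleton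
`Cruxes/UniversalWitnessFamily/Lines/Sketch.lean` (v6).
-/

-- `Summit.<Summit>.<Problem>` is the tree's mandated summit-side namespace (CONVENTIONS §2); for this
-- single-conjunct summit the two coincide, so the duplicate is deliberate.
set_option linter.dupNamespace false

noncomputable section

namespace Summit.FinalStateConjecture.FinalStateConjecture.Theorems.SwallowTheDatum.UniversalWitnessFamily

open scoped Manifold ContDiff Topology InnerProductSpace
open Set Filter Function Literature.Geometry.Lorentzian
open Summit.FinalStateConjecture.FinalStateConjecture.Theorems.SwallowTheDatum.ParametricKerrBurial
  (IsSchwarzschildAnnulus VacuumOn IsIsotropicBeyond)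

/-! ## The radial stretch `Φ z = G(‖z‖²) z` -/

section Stretch

/-- **The stretch profile.** For `0 < λ ≤ 1` there is a smooth non-decreasing `G : ℝ → ℝ` with
`G ≥ λ`, `G = λ` on `(-∞, 5]` and `G = 1` on `[15, ∞)`:
`G t = λ + (1 − λ) S((t − 5)/10)` with `S = Real.smoothTransition`. [folklore] -/
theorem exists_stretchProfile {lam : ℝ} (h1 : lam ≤ 1) :
    ∃ G : ℝ → ℝ, ContDiff ℝ ∞ G ∧ Monotone G ∧ (∀ t, lam ≤ G t) ∧
      (∀ t, t ≤ 5 → G t = lam) ∧ (∀ t, 15 ≤ t → G t = 1) := by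
  refine ⟨fun t ↦ lam + (1 - lam) * Real.smoothTransition ((t - 5) / 10), ?_, ?_, ?_, ?_, ?_⟩
  · exact contDiff_const.add (contDiff_const.mul
      (Real.smoothTransition.contDiff.comp ((contDiff_id.sub contDiff_const).div_const _)))
  · intro a b hab
    have hS : Real.smoothTransition ((a - 5) / 10) ≤ Real.smoothTransition ((b - 5) / 10) :=
      Real.smoothTransition.monotone (by linarith)
    show lam + (1 - lam) * Real.smoothTransition ((a - 5) / 10) ≤
      lam + (1 - lam) * Real.smoothTransition ((b - 5) / 10)
    nlinarith [sub_nonneg.2 h1]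
  · intro t
    show lam ≤ lam + (1 - lam) * Real.smoothTransition ((t - 5) / 10)
    nlinarith [sub_nonneg.2 h1, Real.smoothTransition.nonneg ((t - 5) / 10)]
  · intro t ht
    have hS : Real.smoothTransition ((t - 5) / 10) = 0 :=
      Real.smoothTransition.zero_of_nonpos (by linarith)
    show lam + (1 - lam) * Real.smoothTransition ((t - 5) / 10) = lam
    rw [hS, mul_zero, add_zero]
  · intro t ht
    have hS : Real.smoothTransition ((t - 5) / 10) = 1 :=
      Real.smoothTransition.one_of_one_le (by linarith)
    show lam + (1 - lam) * Real.smoothTransition ((t - 5) / 10) = 1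
    rw [hS]
    ring

variable {G : ℝ → ℝ}

/-- The radial stretch `z ↦ G(‖z‖²) z` of `E3` is smooth for a smooth profile `G` (the square
of the norm is smooth). [folklore] -/
theorem contMDiff_stretch (hG : ContDiff ℝ ∞ G) :
    ContMDiff (𝓡 3) (𝓡 3) (∞ + 1) (fun z : E3 ↦ G (‖z‖ ^ 2) • z) :=
  ((hG.comp (contDiff_norm_sq ℝ)).smul contDiff_id).contMDiff.of_le (le_of_eq (by rfl))

/-- The differential of the radial stretch: `dΦ_z = G(‖z‖²) id + (G′(‖z‖²) · 2⟪z, ·⟫) ⊗ z`.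
[folklore] -/
theorem hasFDerivAt_stretch {G' : ℝ} {z : E3} (hG : HasDerivAt G G' (‖z‖ ^ 2)) :
    HasFDerivAt (fun z : E3 ↦ G (‖z‖ ^ 2) • z)
      (G (‖z‖ ^ 2) • ContinuousLinearMap.id ℝ E3 + (G' • (2 • innerSL ℝ z)).smulRight z) z := by
  have h1 : HasFDerivAt (fun z : E3 ↦ G (‖z‖ ^ 2)) (G' • (2 • innerSL ℝ z)) z :=
    hG.comp_hasFDerivAt z (hasStrictFDerivAt_norm_sq z).hasFDerivAt
  exact h1.smul (hasFDerivAt_id z)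

/-- The linear algebra of the stretch differential: `L = a · id + (2b ⟪z, ·⟫) ⊗ z` with `a > 0`,
`b ≥ 0` is injective, since `⟪L u, u⟫ = a ‖u‖² + 2 b ⟪z, u⟫² ≥ a ‖u‖²`. [folklore] -/
theorem injective_stretchDifferential {a b : ℝ} (ha : 0 < a) (hb : 0 ≤ b) (z : E3) :
    Injective (a • ContinuousLinearMap.id ℝ E3 + (b • (2 • innerSL ℝ z)).smulRight z) := by
  refine (injective_iff_map_eq_zero _).2 fun u hu ↦ ?_
  have key := congrArg (fun x : E3 ↦ ⟪x, u⟫_ℝ) hu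
  simp only [add_apply, FunLike.coe_smul, Pi.smul_apply, ContinuousLinearMap.coe_id', id_eq,
    ContinuousLinearMap.smulRight_apply, innerSL_apply_apply, inner_add_left,
    real_inner_smul_left, inner_zero_left] at key
  simp only [smul_eq_mul, nsmul_eq_mul, Nat.cast_ofNat] at key
  have h2 : 0 ≤ b * (⟪z, u⟫_ℝ * ⟪z, u⟫_ℝ) := mul_nonneg hb (mul_self_nonneg _)
  have h3 : a * ⟪u, u⟫_ℝ ≤ a * 0 := by nlinarith [key, h2]
  exact real_inner_self_nonpos.1 (le_of_mul_le_mul_left h3 ha)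

/-- **The radial stretch is an immersion** for a smooth non-decreasing profile bounded below by
`λ > 0`: `⟪dΦ_z v, v⟫ = G ‖v‖² + 2 G′ ⟪z, v⟫² ≥ λ ‖v‖²`. [folklore] -/
theorem injective_mfderiv_stretch {lam : ℝ} (hG : ContDiff ℝ ∞ G) (hGm : Monotone G)
    (hlam : 0 < lam) (hGlam : ∀ t, lam ≤ G t) (z : E3) :
    Injective (mfderiv (𝓡 3) (𝓡 3) (fun z : E3 ↦ G (‖z‖ ^ 2) • z) z) := by
  have hd : HasDerivAt G (deriv G (‖z‖ ^ 2)) (‖z‖ ^ 2) :=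
    ((hG.differentiable (by simp)) _).hasDerivAt
  rw [mfderiv_eq_fderiv, (hasFDerivAt_stretch hd).fderiv]
  exact injective_stretchDifferential (hlam.trans_le (hGlam _)) hGm.deriv_nonneg z

/-- Where the profile is locally constant, `G(‖·‖²) = c` near `z`, the stretch is the homothety
`y ↦ c y` near `z` and its differential is `c · id`. [folklore] -/
theorem mfderiv_stretch_apply_of_eventually {c : ℝ} {z : E3}
    (h : ∀ᶠ y in 𝓝 z, G (‖y‖ ^ 2) = c) (v : E3) :
    mfderiv (𝓡 3) (𝓡 3) (fun z : E3 ↦ G (‖z‖ ^ 2) • z) z v = c • v := by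
  have h1 : HasFDerivAt (⇑(c • ContinuousLinearMap.id ℝ E3)) (c • ContinuousLinearMap.id ℝ E3) z :=
    (c • ContinuousLinearMap.id ℝ E3).hasFDerivAt
  have h2 : HasFDerivAt (fun z : E3 ↦ G (‖z‖ ^ 2) • z) (c • ContinuousLinearMap.id ℝ E3) z := by
    refine h1.congr_of_eventuallyEq ?_
    filter_upwards [h] with y hy
    rw [hy]
    rfl
  rw [mfderiv_eq_fderiv, h2.fderiv]
  rfl

end Stretch

/-! ## Pulled-back data along a map whose differential at `z` is a homothety -/

section Comap

variable (D : InitialDataSet (𝓡 3) E3) {Φ : E3 → E3} (hΦ : ContMDiff (𝓡 3) (𝓡 3) (∞ + 1) Φ)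
  (hΦ' : ∀ u, Injective (mfderiv (𝓡 3) (𝓡 3) Φ u)) {z : E3}

/-- If `dΦ_z = c · id` then `(Φ^* D).h_z(v, w) = c² h_{Φ z}(v, w)`. [folklore] -/
theorem comap_h_inner_of_mfderiv {c : ℝ} (hd : ∀ v : E3, mfderiv (𝓡 3) (𝓡 3) Φ z v = c • v)
    (v w : E3) :
    (D.comap Φ hΦ hΦ').h.inner z v w = c ^ 2 * D.h.inner (Φ z) v w := by
  rw [InitialDataSet.comap_h_inner, hd v, hd w]
  change D.coordH (Φ z) (c • v) (c • w) = c ^ 2 * D.coordH (Φ z) v w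
  simp only [map_smul, FunLike.coe_smul, Pi.smul_apply, smul_eq_mul]
  ring

/-- If `k_{Φ z} = 0` then `(Φ^* D).k_z = 0`. [folklore] -/
theorem comap_k_eq_zero (hk : D.k (Φ z) = 0) : (D.comap Φ hΦ hΦ').coordK z = 0 := by
  ext v w
  rw [InitialDataSet.coordK_apply, InitialDataSet.comap_k, hk]
  rfl

end Comap

/-! ## The stub -/

/-- **Stub `stub_socketBag_of_plugDataPlusFrom`: from PlugData⁺ (exterior mass prescribed) to the
universal socket bag.** Apply the hypothesis at `μ₀` and `M := 8`, and pull the everywhere-vacuum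
datum `D₀` back along the radial stretch `Φ z = G(‖z‖²) z` (`G = λ` for `‖z‖² ≤ 5`, `G = 1` for
`‖z‖² ≥ 15`, smooth, non-decreasing, `≥ λ`): the pullback is vacuum everywhere (diffeomorphism
equivariance of the constraints, Bartnik–Isenberg 2004 §2), equals the canonical socket
`((1 + μ/2‖z‖)⁴ δ, 0)` on `{1 < ‖z‖ < 2}` (there `Φ = λ · id`, `dΦ = λ · id`, and
`λ² λ⁻² (1 + λμ/(2λ‖z‖))⁴ = (1 + μ/2‖z‖)⁴`) and Schwarzschild(`8`) beyond `4` (there `Φ = id`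
and `4 > ρ₃`). [cite: BartnikIsenberg2004, §2] -/
theorem stub_socketBag_of_plugDataPlusFrom :
  (∀ μ₀ : ℝ, 0 < μ₀ → ∀ M : ℝ, 0 < M →
      ∃ (μ ρ₃ lam : ℝ) (D₀ : InitialDataSet (𝓡 3) E3),
        0 < μ ∧ μ ≤ μ₀ ∧ 0 < ρ₃ ∧ ρ₃ < M / 40 ∧ 0 < lam ∧ 2 * lam < ρ₃ ∧
        (∀ [D₀.metric.HasLeviCivita], D₀.IsVacuumConstraintSolution) ∧
        (∀ y : E3, ρ₃ < ‖y‖ →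
          (∀ v w : E3, D₀.h.inner y v w = Schwarzschild.conformalFactor M y ^ 4 * ⟪v, w⟫_ℝ) ∧ D₀.k y = 0) ∧
        (∀ y : E3, lam < ‖y‖ → ‖y‖ < 2 * lam →
          (∀ v w : E3, D₀.h.inner y v w = (lam ^ 2)⁻¹ * (1 + lam * μ / (2 * ‖y‖)) ^ 4 * ⟪v, w⟫_ℝ) ∧ D₀.k y = 0)) →
  ∀ μ₀ : ℝ, 0 < μ₀ → ∃ μ : ℝ, 0 < μ ∧ μ ≤ μ₀ ∧
    ∃ (M : ℝ) (C : InitialDataSet (𝓡 3) E3), 4 < M ∧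
      VacuumOn {y : E3 | 1 < ‖y‖} C ∧ IsSchwarzschildAnnulus C μ ∧ IsIsotropicBeyond M (M / 2) C := by
  intro hplug μ₀ hμ₀
  obtain ⟨μ, ρ₃, lam, D₀, hμ, hμμ₀, -, hρ₃M, hlam, hlamρ, hvac, hext, hsock⟩ :=
    hplug μ₀ hμ₀ 8 (by norm_num)
  have hlam1 : lam ≤ 1 := by linarith
  obtain ⟨G, hGs, hGm, hGlam, hG5, hG15⟩ := exists_stretchProfile hlam1
  -- the radial stretch and the pulled-back datum
  have hΦ : ContMDiff (𝓡 3) (𝓡 3) (∞ + 1) (fun z : E3 ↦ G (‖z‖ ^ 2) • z) := contMDiff_stretch hGs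
  have hΦ' : ∀ z, Injective (mfderiv (𝓡 3) (𝓡 3) (fun z : E3 ↦ G (‖z‖ ^ 2) • z) z) :=
    injective_mfderiv_stretch hGs hGm hlam hGlam
  refine ⟨μ, hμ, hμμ₀, 8, D₀.comap (fun z : E3 ↦ G (‖z‖ ^ 2) • z) hΦ hΦ', by norm_num, ?_, ?_, ?_⟩
  · -- vacuum everywhere, in particular off the unit ball
    intro inst y _
    haveI := D₀.metric.hasLeviCivita
    exact (D₀.isVacuumConstraintSolution_comap' hΦ hΦ' hvac) y
  · -- the canonical socket annulus `{1 < ‖z‖ < 2}`: there `Φ = λ · id`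
    intro z hz1 hz2
    have hz5 : ‖z‖ ^ 2 < 5 := by nlinarith
    have hev : ∀ᶠ y in 𝓝 z, G (‖y‖ ^ 2) = lam := by
      have ho : IsOpen {y : E3 | ‖y‖ ^ 2 < 5} := isOpen_lt (continuous_norm.pow 2) continuous_const
      filter_upwards [ho.mem_nhds hz5] with y hy
      exact hG5 _ (le_of_lt hy)
    have hd : ∀ v : E3, mfderiv (𝓡 3) (𝓡 3) (fun z : E3 ↦ G (‖z‖ ^ 2) • z) z v = lam • v :=
      mfderiv_stretch_apply_of_eventually hev
    have hn : ‖G (‖z‖ ^ 2) • z‖ = lam * ‖z‖ := by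
      rw [hG5 _ hz5.le, norm_smul, Real.norm_eq_abs, abs_of_pos hlam]
    have h1 : lam < ‖G (‖z‖ ^ 2) • z‖ := by rw [hn]; nlinarith
    have h2 : ‖G (‖z‖ ^ 2) • z‖ < 2 * lam := by rw [hn]; nlinarith
    obtain ⟨hh, hk⟩ := hsock _ h1 h2
    have hl : lam ≠ 0 := hlam.ne'
    have hhE : (D₀.comap (fun z : E3 ↦ G (‖z‖ ^ 2) • z) hΦ hΦ').coordH z =
        (1 + μ / (2 * ‖z‖)) ^ 4 • (innerSL ℝ : E3 →L[ℝ] E3 →L[ℝ] ℝ) := by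
      ext v w
      show (D₀.comap (fun z : E3 ↦ G (‖z‖ ^ 2) • z) hΦ hΦ').h.inner z v w =
        (1 + μ / (2 * ‖z‖)) ^ 4 * ⟪v, w⟫_ℝ
      rw [comap_h_inner_of_mfderiv D₀ hΦ hΦ' hd, hh v w, hn, mul_left_comm (2 : ℝ) lam ‖z‖,
        mul_div_mul_left μ (2 * ‖z‖) hl, ← mul_assoc, ← mul_assoc,
        mul_inv_cancel₀ (pow_ne_zero 2 hl), one_mul]
    exact ⟨hhE, comap_k_eq_zero D₀ hΦ hΦ' hk⟩
  · -- the exterior sheet `{‖z‖ > 4}`: there `Φ = id`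
    intro z hz
    have hz4 : (4 : ℝ) < ‖z‖ := by linarith
    have hz15 : 15 < ‖z‖ ^ 2 := by nlinarith
    have hev : ∀ᶠ y in 𝓝 z, G (‖y‖ ^ 2) = 1 := by
      have ho : IsOpen {y : E3 | 15 < ‖y‖ ^ 2} := isOpen_lt continuous_const (continuous_norm.pow 2)
      filter_upwards [ho.mem_nhds hz15] with y hy
      exact hG15 _ (le_of_lt hy)
    have hd : ∀ v : E3, mfderiv (𝓡 3) (𝓡 3) (fun z : E3 ↦ G (‖z‖ ^ 2) • z) z v = (1 : ℝ) • v :=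
      mfderiv_stretch_apply_of_eventually hev
    have hΦz : G (‖z‖ ^ 2) • z = z := by rw [hG15 _ hz15.le, one_smul]
    have h1 : ρ₃ < ‖G (‖z‖ ^ 2) • z‖ := by rw [hΦz]; linarith
    obtain ⟨hh, hk⟩ := hext _ h1
    have hhE : (D₀.comap (fun z : E3 ↦ G (‖z‖ ^ 2) • z) hΦ hΦ').coordH z =
        (1 + 8 / (2 * ‖z‖)) ^ 4 • (innerSL ℝ : E3 →L[ℝ] E3 →L[ℝ] ℝ) := by
      ext v w
      show (D₀.comap (fun z : E3 ↦ G (‖z‖ ^ 2) • z) hΦ hΦ').h.inner z v w =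
        (1 + 8 / (2 * ‖z‖)) ^ 4 * ⟪v, w⟫_ℝ
      rw [comap_h_inner_of_mfderiv D₀ hΦ hΦ' hd, hh v w, Schwarzschild.conformalFactor_apply, hΦz,
        one_pow, one_mul]
    exact ⟨hhE, comap_k_eq_zero D₀ hΦ hΦ' hk⟩

end Summit.FinalStateConjecture.FinalStateConjecture.Theorems.SwallowTheDatum.UniversalWitnessFamily

end
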